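import Summits.QuantumAdvantage.QuantumAdvantage.Theorems.CharDialSegmentMovesK
import HarnessLib

/-!
# CharDial — segment moves, part L: the SPARSE-FREE-SET dial (decided) and «Young ⊆ the two dials»

Support for `CharDial.WalkHardFJLinOdd` (stmt-QuantumAdvantage-32604), continuing part K.  The degree branch of part K is an ENGINE of its own:
`sparse_hard` — if a junta ⊕ form presentation `D` admits ONE set `S` of `≥ log₂ n` coordinates which every cut's junta ∪ form-support meets
in `≤ √#S` points, then `#{u : ringWinU c D.strat u} ≤ θ·2ⁿ` (any `p`; subcube tube-rank bound `Subcube.card_win_ext_le` +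
`failSet_ge_of_mem_fullSpan` + double counting `sum_card_filter_merge`).  Together with the rank dial (`cubeRank_hard`: the non-constant cuts'
forms in a span of dimension `cubeRate n`) this peels two DECIDED regions off the blocker; `young_in_dials` records, Prop-free, that a Young
presentation over ANY assignment lies in one of the two (few non-empty classes ⇒ span, via `span_of_young` after re-indexing; else the free set
`⋃_b S_b` is sparse) — a second route to part K's `young_hard`.  The blocker's residual = strategies all of whose log-junta presentations escape
both regions (dense, distinct-coefficient, high-rank form families); untouched here.
-/

set_option autoImplicit false

namespace Summit.QuantumAdvantage.AdviceFreeQNC0.JLinPeel.SegMove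

open Finset
open Summit.QuantumAdvantage.AdviceFreeQNC0

variable {n : ℕ} {p : ℕ}

/-- ★ **the sparse-free-set dial**: one common set of `≥ log₂ n` coordinates read sparsely (`≤ √#S` of them, junta bits inside `S`
included) by every cut forces `≤ θ·2ⁿ` wins — the subcube tube-rank engine + double counting (no junta-size and no rank hypothesis needed; any `p`). -/
theorem sparse_hard (p : ℕ) :
    ∃ θ : ℝ, θ < 1 ∧ ∃ n₀ : ℕ, ∀ n ≥ n₀, ∀ (c : ℕ) (D : JLinData p n),
      (∃ S : Finset (Fin n), Nat.log 2 n ≤ S.card ∧ ∀ g, (S.filter fun i => i ∈ D.J g ∨ D.a g i ≠ 0).card ≤ Nat.sqrt S.card) →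
      ((univ.filter fun u : Fin n → Bool => ringWinU c D.strat u = true).card : ℝ) ≤ θ * (2 : ℝ) ^ n := by
  obtain ⟨c₀, hc₀, m₀, hcore⟩ := failSet_ge_of_mem_fullSpan
  refine ⟨1 - c₀, by linarith, 2 ^ m₀, fun n hn c D hS => ?_⟩
  obtain ⟨S, hSlog, hSK⟩ := hS
  have h2n : (0 : ℝ) < (2 : ℝ) ^ n := by positivity
  have hm₀log : m₀ ≤ Nat.log 2 n := Nat.le_log_of_pow_le one_lt_two hn
  set W : Finset (Fin n) := univ \ S with hW
  have hWc : W.card + S.card = n := by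
    have h := Finset.card_sdiff_add_card_eq_card (Finset.subset_univ S)
    rw [Finset.card_univ, Fintype.card_fin] at h
    exact h
  have hNW : n - W.card = S.card := by omega
  have hfree : ∀ i : Fin n, i ∉ W → i ∈ S := by
    intro i hi
    by_contra h
    exact hi (Finset.mem_sdiff.mpr ⟨mem_univ _, h⟩)
  have hm₀N : m₀ ≤ n - W.card := by rw [hNW]; exact le_trans hm₀log hSlog
  have hDN : Nat.sqrt S.card ≤ Nat.sqrt (n - W.card) := by rw [hNW]
  have hdeg : ∀ (a : Fin n → Bool) (g : Fin (n + 1)),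
      HasDeg (fun u => D.strat g (AffBells22.subcubeMerge W a u)) (Nat.sqrt S.card) := by
    intro a g
    refine BlockFibre37.hasDeg_of_dependsOn (S.filter fun i => i ∈ D.J g ∨ D.a g i ≠ 0) (hSK g) fun u v huv => ?_
    have hmerge_J : ∀ i ∈ D.J g, AffBells22.subcubeMerge W a u i = AffBells22.subcubeMerge W a v i := by
      intro i hi
      unfold AffBells22.subcubeMerge
      by_cases hiW : i ∈ W
      · simp [hiW]
      · simp only [hiW, if_false]
        exact huv i (mem_filter.mpr ⟨hfree i hiW, Or.inl hi⟩)
    have hform : form (D.a g) (AffBells22.subcubeMerge W a u) = form (D.a g) (AffBells22.subcubeMerge W a v) := by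
      unfold form
      refine Finset.sum_congr rfl fun i _ => ?_
      by_cases ha : D.a g i = 0
      · simp [ha]
      · have hmi : AffBells22.subcubeMerge W a u i = AffBells22.subcubeMerge W a v i := by
          unfold AffBells22.subcubeMerge
          by_cases hiW : i ∈ W
          · simp [hiW]
          · simp only [hiW, if_false]
            exact huv i (mem_filter.mpr ⟨hfree i hiW, Or.inr ha⟩)
        rw [hmi]
    show D.h g (AffBells22.subcubeMerge W a u) (form (D.a g) (AffBells22.subcubeMerge W a u))
      = D.h g (AffBells22.subcubeMerge W a v) (form (D.a g) (AffBells22.subcubeMerge W a v))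
    rw [hform]
    exact D.hJ g _ _ hmerge_J _
  have hper : ∀ a : Fin n → Bool,
      ((univ.filter fun u : Fin n → Bool => ringWinU c D.strat (AffBells22.subcubeMerge W a u) = true).card : ℝ)
        ≤ (1 - c₀) * (2 : ℝ) ^ n := by
    intro a
    have h1 := Subcube.card_filter_merge_le W a (fun w => ringWinU c D.strat w = true)
    have h2 := Subcube.card_win_ext_le W a hcore hm₀N hDN c D.strat (hdeg a)
    have h1R : ((univ.filter fun u : Fin n → Bool => ringWinU c D.strat (AffBells22.subcubeMerge W a u) = true).card : ℝ)
        ≤ (2 : ℝ) ^ W.card *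
          ((univ.filter fun v : Fin (n - W.card) → Bool => ringWinU c D.strat (Subcube.ext W a v) = true).card : ℝ) := by
      exact_mod_cast h1
    have hpow : (2 : ℝ) ^ W.card * (2 : ℝ) ^ (n - W.card) = (2 : ℝ) ^ n := by
      rw [← pow_add, Subcube.card_add_sub]
    have h2' : (2 : ℝ) ^ W.card *
          ((univ.filter fun v : Fin (n - W.card) → Bool => ringWinU c D.strat (Subcube.ext W a v) = true).card : ℝ)
        ≤ (2 : ℝ) ^ W.card * ((1 - c₀) * (2 : ℝ) ^ (n - W.card)) := mul_le_mul_of_nonneg_left h2 (by positivity)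
    calc _ ≤ _ := h1R
      _ ≤ _ := h2'
      _ = (1 - c₀) * (2 : ℝ) ^ n := by rw [← hpow]; ring
  have hsum := sum_card_filter_merge W (fun w => ringWinU c D.strat w = true)
  have hsumR : (2 : ℝ) ^ n * ((univ.filter fun w : Fin n → Bool => ringWinU c D.strat w = true).card : ℝ)
      = ∑ a : Fin n → Bool,
          ((univ.filter fun u : Fin n → Bool => ringWinU c D.strat (AffBells22.subcubeMerge W a u) = true).card : ℝ) := by
    exact_mod_cast hsum.symm
  have hle : ∑ a : Fin n → Bool,
        ((univ.filter fun u : Fin n → Bool => ringWinU c D.strat (AffBells22.subcubeMerge W a u) = true).card : ℝ)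
      ≤ ∑ _a : Fin n → Bool, (1 - c₀) * (2 : ℝ) ^ n := Finset.sum_le_sum fun a _ => hper a
  rw [Finset.sum_const, Finset.card_univ, Fintype.card_fun, Fintype.card_bool, Fintype.card_fin, nsmul_eq_mul] at hle
  push_cast at hle
  rw [← hsumR] at hle
  exact le_of_mul_le_mul_left hle h2n

/-- a Young presentation over `≤ cubeRate n` classes has its forms in the span of the `≤ cubeRate n` class indicators (the rank dial). -/
theorem span_of_young {B : ℕ} (π : Fin n → Fin B) (hB : B ≤ cubeRate n) (D : JLinData p n)
    (hY : ∀ g, ∃ β : Fin B, ∃ l : ZMod p, D.a g = fun i => if π i = β then l else 0) :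
    (∃ A : Fin (cubeRate n) → Fin n → ZMod p, ∀ g, ¬ (∀ (u : Fin n → Bool) (s s' : ZMod p), D.h g u s = D.h g u s') → ∃ l : Fin (cubeRate n) → ZMod p, D.a g = fun i => ∑ j, l j * A j i) := by
  choose β l hβl using hY
  refine ⟨fun (j : Fin (cubeRate n)) (i : Fin n) => if (π i).val = j.val then (1 : ZMod p) else 0, fun g _ => ?_⟩
  refine ⟨fun j => if j.val = (β g).val then l g else 0, ?_⟩
  rw [hβl g]
  funext i
  rw [Finset.sum_eq_single ⟨(β g).val, lt_of_lt_of_le (β g).isLt hB⟩]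
  · by_cases hπ : π i = β g
    · simp [hπ]
    · have hne : (π i).val ≠ (β g).val := fun h => hπ (Fin.ext h)
      simp [hπ, hne]
  · intro j _ hj
    have hne : j.val ≠ (β g).val := fun h => hj (Fin.ext h)
    simp [hne]
  · intro h
    exact absurd (Finset.mem_univ _) h

/-- ★ **Young presentations lie in the two dials** (all large `n`, any `p`, any assignment): either the free set `⋃_b S_b` of part K
(`min(#class, 4 log₂ n + 4)` coordinates per class) is a sparse common free set, or there are `< (5 log₂ n + 4)² ≤ cubeRate n` non-empty
classes and the re-indexed class indicators span every form. -/
theorem young_in_dials (p : ℕ) : ∃ n₀ : ℕ, ∀ n ≥ n₀, ∀ (B : ℕ) (π : Fin n → Fin B) (D : JLinData p n),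
    (∀ g, (D.J g).card ≤ Nat.log 2 n) → (∀ g, ∃ β : Fin B, ∃ l : ZMod p, D.a g = fun i => if π i = β then l else 0) →
      (∃ A : Fin (cubeRate n) → Fin n → ZMod p, ∀ g, ¬ (∀ (u : Fin n → Bool) (s s' : ZMod p), D.h g u s = D.h g u s') → ∃ l : Fin (cubeRate n) → ZMod p, D.a g = fun i => ∑ j, l j * A j i)
      ∨ (∃ S : Finset (Fin n), Nat.log 2 n ≤ S.card ∧ ∀ g, (S.filter fun i => i ∈ D.J g ∨ D.a g i ≠ 0).card ≤ Nat.sqrt S.card) := by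
  obtain ⟨N₀, hN₀⟩ := DWalk.const_mul_logPow_le' (81 ^ 3) 11
  refine ⟨max N₀ 2, fun n hn B π D hJ hY => ?_⟩
  have hnN₀ : N₀ ≤ n := le_trans (le_max_left _ _) hn
  have hn2 : 2 ≤ n := le_trans (le_max_right _ _) hn
  set L := Nat.log 2 n with hL
  have hL1 : 1 ≤ L := Nat.le_log_of_pow_le one_lt_two (by rw [pow_one]; exact hn2)
  set t := 4 * L + 4 with ht
  set cls : Fin B → Finset (Fin n) := fun b => univ.filter fun i : Fin n => π i = b with hcls
  have hex : ∀ b, ∃ T ⊆ cls b, T.card = min (cls b).card t := fun b => Finset.exists_subset_card_eq (min_le_left _ _)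
  choose Sb hSbsub hSbcard using hex
  set S : Finset (Fin n) := univ.biUnion Sb with hS
  set N := S.card with hN
  have hdisj : ∀ b ∈ (univ : Finset (Fin B)), ∀ b' ∈ (univ : Finset (Fin B)), b ≠ b' → Disjoint (Sb b) (Sb b') := by
    intro b _ b' _ hbb'
    exact Finset.disjoint_left.mpr fun i hi hi' =>
      hbb' ((mem_filter.mp (hSbsub b hi)).2.symm.trans (mem_filter.mp (hSbsub b' hi')).2)
  have hNsum : N = ∑ b, (Sb b).card := by rw [hN, hS, Finset.card_biUnion hdisj]
  have hSb_cls : ∀ b, ∀ i ∈ Sb b, π i = b := fun b i hi => (mem_filter.mp (hSbsub b hi)).2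
  have hSmem : ∀ i ∈ S, i ∈ Sb (π i) := by
    intro i hiS
    rw [hS, Finset.mem_biUnion] at hiS
    obtain ⟨b, _, hb⟩ := hiS
    have hπb : π i = b := hSb_cls b i hb
    rw [hπb]
    exact hb
  choose β l hβl using hY
  by_cases hA : (5 * L + 4) * (5 * L + 4) ≤ N
  · -- SPARSE dial, witnessed by `S`
    right
    refine ⟨S, ?_, fun g => ?_⟩
    · have h1 : L ≤ 5 * L + 4 := by omega
      have h2 : 5 * L + 4 ≤ (5 * L + 4) * (5 * L + 4) := Nat.le_mul_self _
      omega
    · have hsub : (S.filter fun i => i ∈ D.J g ∨ D.a g i ≠ 0) ⊆ D.J g ∪ Sb (β g) := by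
        intro i hi
        obtain ⟨hiS, hJa⟩ := mem_filter.mp hi
        rcases hJa with hiJ | hai
        · exact Finset.mem_union_left _ hiJ
        · have hπ : π i = β g := by
            by_contra hπ
            apply hai
            rw [hβl g]
            simp [hπ]
          refine Finset.mem_union_right _ ?_
          rw [← hπ]
          exact hSmem i hiS
      calc (S.filter fun i => i ∈ D.J g ∨ D.a g i ≠ 0).card ≤ (D.J g ∪ Sb (β g)).card := Finset.card_le_card hsub
        _ ≤ (D.J g).card + (Sb (β g)).card := Finset.card_union_le _ _
        _ ≤ L + t := add_le_add (hJ g) (by rw [hSbcard]; exact min_le_right _ _)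
        _ = 5 * L + 4 := by rw [ht]; ring
        _ ≤ Nat.sqrt N := Nat.le_sqrt.mpr hA
  · -- RANK dial: few non-empty classes, re-indexed
    left
    have hQ : N < (5 * L + 4) * (5 * L + 4) := not_le.mp hA
    set T : Finset (Fin B) := univ.filter fun b => (cls b).Nonempty with hT
    have hmemT : ∀ i : Fin n, π i ∈ T := fun i =>
      mem_filter.mpr ⟨mem_univ _, ⟨i, mem_filter.mpr ⟨mem_univ _, rfl⟩⟩⟩
    have hTN : T.card ≤ N := by
      have h1 : ∀ b ∈ T, 1 ≤ (Sb b).card := by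
        intro b hb
        rw [hSbcard]
        exact le_min (Finset.card_pos.mpr (mem_filter.mp hb).2) (by omega)
      calc T.card = ∑ b ∈ T, 1 := by simp
        _ ≤ ∑ b ∈ T, (Sb b).card := Finset.sum_le_sum h1
        _ ≤ ∑ b, (Sb b).card :=
            Finset.sum_le_sum_of_subset_of_nonneg (Finset.subset_univ _) fun _ _ _ => Nat.zero_le _
        _ = N := hNsum.symm
    have hQcr : (5 * L + 4) * (5 * L + 4) ≤ cubeRate n := by
      have h54 : 5 * L + 4 ≤ 9 * L := by omega
      have hρ : (5 * L + 4) * (5 * L + 4) ≤ 81 * L ^ 2 := by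
        calc (5 * L + 4) * (5 * L + 4) ≤ 9 * L * (9 * L) := Nat.mul_le_mul h54 h54
          _ = 81 * L ^ 2 := by ring
      refine le_trans hρ (le_cubeRate ?_ ?_)
      · calc 81 * L ^ 2 ≤ 81 ^ 3 * L ^ 11 :=
              Nat.mul_le_mul (Nat.le_self_pow (by norm_num) _) (Nat.pow_le_pow_right hL1 (by norm_num))
          _ ≤ n := hN₀ n hnN₀
      · calc (81 * L ^ 2) ^ 3 * L ^ 5 = 81 ^ 3 * L ^ 11 := by ring
          _ ≤ n := hN₀ n hnN₀
    have hTcr : T.card ≤ cubeRate n := by omega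
    let e : {b // b ∈ T} ≃ Fin T.card := T.equivFin
    let π' : Fin n → Fin T.card := fun i => e ⟨π i, hmemT i⟩
    have i₀ : Fin n := ⟨0, by omega⟩
    have hY' : ∀ g, ∃ β' : Fin T.card, ∃ l' : ZMod p, D.a g = fun i => if π' i = β' then l' else 0 := by
      intro g
      by_cases hne : (cls (β g)).Nonempty
      · have hβT : β g ∈ T := mem_filter.mpr ⟨mem_univ _, hne⟩
        refine ⟨e ⟨β g, hβT⟩, l g, ?_⟩
        rw [hβl g]
        funext i
        have hiff : π i = β g ↔ π' i = e ⟨β g, hβT⟩ := by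
          constructor
          · intro h
            show e ⟨π i, hmemT i⟩ = e ⟨β g, hβT⟩
            congr 1
            exact Subtype.ext h
          · intro h
            exact congrArg Subtype.val (e.injective h)
        by_cases hπ : π i = β g
        · rw [if_pos hπ, if_pos (hiff.mp hπ)]
        · rw [if_neg hπ, if_neg (fun h => hπ (hiff.mpr h))]
      · refine ⟨π' i₀, 0, ?_⟩
        rw [hβl g]
        funext i
        have hπ : π i ≠ β g := fun h => hne ⟨i, mem_filter.mpr ⟨mem_univ _, h⟩⟩
        rw [if_neg hπ]
        split_ifs <;> rfl
    exact span_of_young π' hTcr D hY'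

end Summit.QuantumAdvantage.AdviceFreeQNC0.JLinPeel.SegMove
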